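import Summits.QuantumFields.YangMills.Theorems.OneCertifiedCubeFiniteSizeCriterionRecursion
import HarnessLib

/-!
# The OUTER-tempered Dobrushin–Shlosman block recursion (BalabanLadder IR line L2″ v9, engine part 1/3)

Helper module for item `stmt-QuantumFields-19354` (crux `IR` of route `BalabanLadder`; registered line L2″,
skeleton of record `IR_birth_cell_v9.lean` «outer-shell tempering»; engine stub `Cruxes.IR.CellTempered.stub_outerToTV`).
Route owner ym-beyond-p2 (g18), filed by the cell's courier.

WHY (owner's third audit, 2026-08-26).  Clause (i) of the v6–v8 certificate `CellTemperedCond` let a tempered pair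
of data differ («both good») on cells ADJACENT to the centre cell; jointly with the per-cell rarity clause (ii) that
is unsatisfiable at weak coupling (the centre kernel's law is TV-far for frame-inequivalent adjacent data).  The
landed engine `Engine.tempered_recursion_step` (module `Theorems.BalabanLadderIRTemperedRecursionStep`) never used
that freedom: its tempered hypothesis is invoked once, on pairs from `Rgood`, which AGREE on every cell within cell
radius `2n` of the centre off `Λ₀` and are «equal or both good» only on the OUTER SHELL (radius exactly `2n+1`).
This module is that theorem with the correspondingly WEAKENED hypothesis `hFS`: its good branch carries the extra
conjunct `¬ ∀ i, |cell v i - x i| ≤ 2n`, supplied at the single use site from `v ∈ Λ`, `v ∉ Λ₀ = Λ ∩ cube`.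
Everything else — setting (a range-one specification `γ` on `ZdEdge d → S` read through a contracting cell map,
`hloc`, `hC1`, `hfin`), the per-cell rarity hypothesis `hBad`, the statement's conclusion and the proof — is the
landed module's, byte-identical up to that one line.

* `outer_recursion_step` — output `≤ ε·M·δ + 4·M·δ'` (`M = (4n+3)ᵈ - (4n+1)ᵈ`) under the outer-tempered `hFS`.

Parts 2/3 (`Theorems.BalabanLadderIROuterRecursion`: `outer_recursion_decay`) and 3/3
(`Theorems.BalabanLadderIROuterToTV`: `hFS_of_mix_outer`, `outerToTV_proved`) iterate it and read off the sub-region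
total-variation hypothesis of `Theses.OneCertifiedCube.FiniteSizeCriterion` at a coarser window from the v9
certificate's clause (i♭).

## References
* R. L. Dobrushin, S. B. Shlosman, *Constructive criterion for the uniqueness of Gibbs field*
  (1985), §2; *Completely analytical Gibbs fields* (1985).
* L. A. Bassalygo, R. L. Dobrushin, *Uniqueness of a Gibbs field with random potential — an
  elementary approach*, Theory Probab. Appl. 31 (1986) (tempered / «bad set» criteria).
* J. van den Berg, C. Maes, *Disagreement percolation in the study of Markov fields*, Ann. Probab.
  22 (1994).
-/

noncomputable section

open MeasureTheory
open Literature.Probability.LatticeModels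
open Literature.MathematicalPhysics.QuantumLattice
open Summit.QuantumFields.YangMills.Theorems.FiniteSizeCriterion

namespace Summit.QuantumFields.YangMills.Cruxes.IR.CellTempered.OuterEngine

variable {d : ℕ} {S : Type*} [MeasurableSpace S]

/-- **Outer-tempered recursion step** (= `Engine.tempered_recursion_step` under the weaker pair hypothesis whose
good branch is restricted to cells OUTSIDE the radius-`2n` cube; generalises
`Theorems.FiniteSizeCriterion.recursion_step`, the case `Good ≡ univ`, `δ' = 0`). -/
theorem outer_recursion_step {γ : Specification (ZdEdge d) S} (hγ : IsSpecification γ)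
    (hloc : ∀ (Λ : Finset (ZdEdge d)) (f : (ZdEdge d → S) → ℝ) (T : Finset (ZdEdge d)),
      Measurable f → DependsOn f ↑T →
        DependsOn (fun η => ∫ σ, f σ ∂(γ Λ η)) ↑(T ∪ (plaquettesTouching Λ).biUnion plaquetteEdges))
    {cell : ZdEdge d → (Fin d → ℤ)}
    (hC1 : ∀ e e' : ZdEdge d, (∀ k, e'.1 k - 1 ≤ e.1 k ∧ e.1 k ≤ e'.1 k + 1) →
      ∀ k, |cell e k - cell e' k| ≤ 1)
    (hfin : ∀ y : Fin d → ℤ, Set.Finite {v : ZdEdge d | cell v = y})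
    {n : ℕ} {ε : ℝ} (hε : 0 ≤ ε) (hε1 : ε ≤ 1)
    (Good : (Fin d → ℤ) → (Fin d → ℤ) → Set (ZdEdge d → S))
    (hGm : ∀ x c, MeasurableSet (Good x c))
    {δ' : ℝ} (hδ' : 0 ≤ δ')
    (hBad : ∀ (x c : Fin d → ℤ) (E : Finset (ZdEdge d)), (∀ v, cell v = c → v ∈ E) →
      ∀ ζ : ZdEdge d → S, (γ E ζ) (Good x c)ᶜ ≤ ENNReal.ofReal δ')
    (hFS : ∀ (x : Fin d → ℤ) (Λ₀ : Finset (ZdEdge d)),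
      (∀ v w, cell v = cell w → v ∈ Λ₀ → w ∈ Λ₀) →
      (∀ v ∈ Λ₀, ∀ i, |cell v i - x i| ≤ 2 * n) → (∀ v, cell v = x → v ∈ Λ₀) →
      ∀ η η' : ZdEdge d → S,
        (∀ v, v ∉ Λ₀ → (∀ i, |cell v i - x i| ≤ 2 * n + 1) →
          (η v = η' v ∨ ((¬ ∀ i, |cell v i - x i| ≤ 2 * n) ∧
            η ∈ Good x (cell v) ∧ η' ∈ Good x (cell v)))) →
      ∀ f : (ZdEdge d → S) → ℝ, DependsOn f {v | cell v = x} → Measurable f →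
        (∀ σ, 0 ≤ f σ ∧ f σ ≤ 1) → |∫ σ, f σ ∂(γ Λ₀ η) - ∫ σ, f σ ∂(γ Λ₀ η')| ≤ ε)
    {j : ℕ} {δ : ℝ}
    (hT : ∀ (Λ : Finset (ZdEdge d)), (∀ v w, cell v = cell w → v ∈ Λ → w ∈ Λ) →
      ∀ (x : Fin d → ℤ) (g : (ZdEdge d → S) → ℝ), Measurable g → (∀ σ, 0 ≤ g σ ∧ g σ ≤ 1) →
      DependsOn g {v | cell v = x} →
      ∀ ζ ζ' : ZdEdge d → S,
        (∀ v, v ∉ Λ → (∀ i, |cell v i - x i| ≤ j * (2 * n + 1)) → ζ v = ζ' v) →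
        |∫ σ, g σ ∂(γ Λ ζ) - ∫ σ, g σ ∂(γ Λ ζ')| ≤ δ)
    (Λ : Finset (ZdEdge d)) (hΛ : ∀ v w, cell v = cell w → v ∈ Λ → w ∈ Λ)
    (x : Fin d → ℤ) (g : (ZdEdge d → S) → ℝ) (hgm : Measurable g) (hg01 : ∀ σ, 0 ≤ g σ ∧ g σ ≤ 1)
    (hgdep : DependsOn g {v | cell v = x}) (ζ ζ' : ZdEdge d → S)
    (hagree : ∀ v, v ∉ Λ → (∀ i, |cell v i - x i| ≤ (j + 1) * (2 * n + 1)) → ζ v = ζ' v) :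
    |∫ σ, g σ ∂(γ Λ ζ) - ∫ σ, g σ ∂(γ Λ ζ')| ≤
      ε * (((2 * (2 * n + 1) + 1) ^ d - (2 * (2 * n) + 1) ^ d : ℕ) : ℝ) * δ +
        4 * (((2 * (2 * n + 1) + 1) ^ d - (2 * (2 * n) + 1) ^ d : ℕ) : ℝ) * δ' := by
  classical
  -- `δ ≥ 0`: the single-cell hypothesis at a constant observable
  have hδ : 0 ≤ δ := (abs_nonneg _).trans (hT ∅ (fun v _ _ h => absurd h (Finset.notMem_empty v))
    x (fun _ => 0) measurable_const (fun _ => ⟨le_rfl, zero_le_one⟩) (fun _ _ _ => rfl) ζ ζ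
    (fun _ _ _ => rfl))
  set M : ℝ := (((2 * (2 * n + 1) + 1) ^ d - (2 * (2 * n) + 1) ^ d : ℕ) : ℝ) with hM
  have hM0 : 0 ≤ M := by rw [hM]; positivity
  have hMδ : 0 ≤ ε * M * δ + 4 * M * δ' := by positivity
  set R : ℤ := 2 * n with hR
  have hR0 : (0 : ℤ) ≤ R := by rw [hR]; positivity
  have hR1 : R + 1 ≤ (j + 1 : ℤ) * (2 * n + 1) := by rw [hR]; nlinarith
  -- trivial case: the cell `x` does not meet `Λ`
  by_cases hx : ∃ v ∈ Λ, cell v = x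
  swap
  · have hgc : DependsOn g ((↑Λ : Set (ZdEdge d))ᶜ) := fun σ σ' h =>
      hgdep fun v (hv : cell v = x) => h v fun hvΛ => hx ⟨v, Finset.mem_coe.1 hvΛ, hv⟩
    rw [kernel_integral_eq_of_dependsOn_compl hγ Λ hgc ζ,
      kernel_integral_eq_of_dependsOn_compl hγ Λ hgc ζ']
    have hζ : g ζ = g ζ' := hgdep fun v (hv : cell v = x) =>
      hagree v (fun hvΛ => hx ⟨v, hvΛ, hv⟩) fun i => by
        rw [hv, sub_self, abs_zero]; positivity
    rw [hζ, sub_self, abs_zero]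
    exact hMδ
  -- the localised volume `Λ₀ = Λ ∩ cube`
  obtain ⟨v₀, hv₀Λ, hv₀x⟩ := hx
  set Λ₀ : Finset (ZdEdge d) := Λ.filter fun v => ∀ i, |cell v i - x i| ≤ R with hΛ₀
  have hΛ₀Λ : Λ₀ ⊆ Λ := Finset.filter_subset _ _
  have hΛ₀union : ∀ v w, cell v = cell w → v ∈ Λ₀ → w ∈ Λ₀ := fun v w hvw hv => by
    rw [hΛ₀, Finset.mem_filter] at hv ⊢
    exact ⟨hΛ v w hvw hv.1, fun i => hvw ▸ hv.2 i⟩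
  have hΛ₀near : ∀ v ∈ Λ₀, ∀ i, |cell v i - x i| ≤ 2 * n := fun v hv =>
    (Finset.mem_filter.1 hv).2
  have hxΛ₀ : ∀ v, cell v = x → v ∈ Λ₀ := fun v hv =>
    Finset.mem_filter.2 ⟨hΛ v₀ v (hv₀x.trans hv.symm) hv₀Λ, fun i => by
      rw [hv, sub_self, abs_zero]; exact hR0⟩
  have hnotΛ : ∀ v, v ∉ Λ₀ → (∀ i, |cell v i - x i| ≤ R) → v ∉ Λ := fun v hv hd hvΛ =>
    hv (Finset.mem_filter.2 ⟨hvΛ, hd⟩)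
  -- the localised observable `g₀ = γ_{Λ₀} g`
  set g₀ : (ZdEdge d → S) → ℝ := fun σ => ∫ τ, g τ ∂(γ Λ₀ σ) with hg₀
  have hg₀m : Measurable g₀ := DobrushinShlosman.measurable_windowAvg' hγ Λ₀ hgm
  have hg₀01 : ∀ σ, 0 ≤ g₀ σ ∧ g₀ σ ≤ 1 := fun σ => by
    haveI := hγ.isProbability Λ₀ σ
    exact integral_mem_unitInterval hgm hg01
  have hg1 : ∀ σ, |g σ| ≤ 1 := fun σ => by rw [abs_of_nonneg (hg01 σ).1]; exact (hg01 σ).2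
  have hcons : ∀ η, ∫ σ, g σ ∂(γ Λ η) = ∫ σ, g₀ σ ∂(γ Λ η) := fun η =>
    (kernel_integral_integral_eq_of_subset hγ hΛ₀Λ η hgm hg1).symm
  -- `g₀` depends only on the edges off `Λ₀` within cell distance `R + 1`
  have hgT : DependsOn g (↑(hfin x).toFinset : Set (ZdEdge d)) := fun σ σ' h =>
    hgdep fun v hv => h v (by rw [Set.Finite.coe_toFinset]; exact hv)
  have hg₀dep' := hloc Λ₀ g (hfin x).toFinset hgm hgT
  have hg₀dep : DependsOn g₀ {v | v ∉ Λ₀ ∧ ∀ i, |cell v i - x i| ≤ R + 1} := by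
    intro σ σ' h
    let σ'' : ZdEdge d → S := fun v => if v ∈ Λ₀ then σ v else σ' v
    have e1 : g₀ σ' = g₀ σ'' := by
      simp only [hg₀]
      rw [DobrushinShlosman.spec_apply_congr hγ Λ₀ (ω := σ') (η := σ'') fun v hv => by
        simp only [σ'', hv, if_false]]
    have e2 : g₀ σ'' = g₀ σ := by
      refine hg₀dep' fun v hv => ?_
      by_cases hvΛ₀ : v ∈ Λ₀
      · simp only [σ'', hvΛ₀, if_true]
      · simp only [σ'', hvΛ₀, if_false]
        refine (h v ⟨hvΛ₀, ?_⟩).symm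
        rcases Finset.mem_union.1 (Finset.mem_coe.1 hv) with hvT | hvC
        · have hvx : cell v = x := (hfin x).mem_toFinset.1 hvT
          intro i; rw [hvx, sub_self, abs_zero]; positivity
        · obtain ⟨e', he', hnear⟩ := exists_near_of_mem_collar hvC
          intro i
          have h1 := hC1 v e' hnear i
          have h2 := hΛ₀near e' he' i
          calc |cell v i - x i| = |(cell v i - cell e' i) + (cell e' i - x i)| := by ring_nf
            _ ≤ |cell v i - cell e' i| + |cell e' i - x i| := abs_add_le _ _
            _ ≤ 1 + R := add_le_add h1 h2
            _ = R + 1 := add_comm _ _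
    rw [← e2, ← e1]
  -- TEMPERED: the good configurations — pinned to `ζ` off `Λ` within `R + 1`, good on the shell
  -- cells inside `Λ`
  set Rgood : Set (ZdEdge d → S) := {σ | (∀ v, v ∉ Λ → (∀ i, |cell v i - x i| ≤ R + 1) →
      σ v = ζ v) ∧ (∀ v, v ∈ Λ → v ∉ Λ₀ → (∀ i, |cell v i - x i| ≤ R + 1) →
      σ ∈ Good x (cell v))} with hRgood
  -- oscillation `≤ ε` of `g₀` on `Rgood` (tempered finite-size condition)
  have hosc : ∀ σ σ' : ZdEdge d → S, σ ∈ Rgood → σ' ∈ Rgood → |g₀ σ - g₀ σ'| ≤ ε := by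
    intro σ σ' hσ hσ'
    refine hFS x Λ₀ hΛ₀union hΛ₀near hxΛ₀ σ σ' (fun v hv hd => ?_) g hgdep hgm hg01
    by_cases hvΛ : v ∈ Λ
    · exact Or.inr ⟨fun hd' => hv (Finset.mem_filter.2 ⟨hvΛ, hd'⟩), hσ.2 v hvΛ hv hd,
        hσ'.2 v hvΛ hv hd⟩
    · exact Or.inl ((hσ.1 v hvΛ hd).trans (hσ'.1 v hvΛ hd).symm)
  -- the infimum `a` of `g₀` over `Rgood`
  have hbdd : BddBelow (g₀ '' Rgood) := ⟨0, fun r ⟨σ, _, hr⟩ => hr ▸ (hg₀01 σ).1⟩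
  set a : ℝ := sInf (g₀ '' Rgood) with ha
  have ha_le : ∀ σ ∈ Rgood, a ≤ g₀ σ := fun σ hσ => csInf_le hbdd ⟨σ, hσ, rfl⟩
  have hle_a : ∀ σ ∈ Rgood, g₀ σ ≤ a + ε := fun σ hσ => by
    have h : g₀ σ - ε ≤ a := le_csInf ⟨g₀ σ, σ, hσ, rfl⟩ fun r ⟨σ', hσ', hr⟩ => by
      rw [← hr]
      have := abs_le.1 (hosc σ σ' hσ hσ')
      linarith
    linarith
  have ha01 : 0 ≤ a ∧ a ≤ 1 := by
    by_cases hne : (g₀ '' Rgood).Nonempty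
    · obtain ⟨r, σ, hσ, rfl⟩ := hne
      exact ⟨le_csInf ⟨g₀ σ, σ, hσ, rfl⟩ fun r ⟨σ', _, hr⟩ => hr ▸ (hg₀01 σ').1,
        (ha_le σ hσ).trans (hg₀01 σ).2⟩
    · rw [Set.not_nonempty_iff_eq_empty] at hne
      rw [ha, hne, Real.sInf_empty]
      exact ⟨le_rfl, zero_le_one⟩
  -- the shell cells of `Λ` and the frozen, rescaled observable `H` (UNCHANGED)
  set Ysh : Finset (Fin d → ℤ) := (Λ.image cell).filter fun y =>
    (∀ i, |y i - x i| ≤ R + 1) ∧ ¬ (∀ i, |y i - x i| ≤ R) with hYsh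
  let Φ : (ZdEdge d → S) → (ZdEdge d → S) := fun σ v => if cell v ∈ Ysh then σ v else ζ v
  have hΦm : Measurable Φ := by
    refine measurable_pi_iff.2 fun v => ?_
    by_cases hv : cell v ∈ Ysh
    · simp only [Φ, hv, if_true]; exact measurable_pi_apply v
    · simp only [Φ, hv, if_false]; exact measurable_const
  set H : (ZdEdge d → S) → ℝ := fun σ => min 1 (max 0 ((g₀ (Φ σ) - a) / ε)) with hH
  have hHm : Measurable H :=
    measurable_const.min (measurable_const.max (((hg₀m.comp hΦm).sub_const a).div_const ε))
  have hH01 : ∀ σ, 0 ≤ H σ ∧ H σ ≤ 1 := fun σ =>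
    ⟨le_min zero_le_one (le_max_left _ _), min_le_left _ _⟩
  have hHdep : DependsOn H {v | cell v ∈ Ysh} := by
    intro σ σ' h
    simp only [hH]
    have hΦ : Φ σ = Φ σ' := funext fun v => by
      by_cases hv : cell v ∈ Ysh
      · simp only [Φ, hv, if_true]; exact h v hv
      · simp only [Φ, hv, if_false]
    rw [hΦ]
  -- TEMPERED: the bad event — some shell cell inside `Λ` is not good
  set YΛ : Finset (Fin d → ℤ) := (Λ.filter fun v => v ∉ Λ₀ ∧ ∀ i, |cell v i - x i| ≤ R + 1).image
    cell with hYΛ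
  set B : Set (ZdEdge d → S) := ⋃ c ∈ YΛ, (Good x c)ᶜ with hB
  have hBm : MeasurableSet B := Finset.measurableSet_biUnion _ fun c _ => (hGm x c).compl
  have hYΛcard : YΛ.card ≤ (2 * (2 * n + 1) + 1) ^ d - (2 * (2 * n) + 1) ^ d := by
    refine card_shell_le x (2 * n) YΛ fun y hy => ?_
    obtain ⟨v, hv, rfl⟩ := Finset.mem_image.1 hy
    obtain ⟨hvΛ, hvΛ₀, hd⟩ := Finset.mem_filter.1 hv
    refine ⟨fun i => by exact_mod_cast hd i, fun hnear => hvΛ₀ (Finset.mem_filter.2 ⟨hvΛ, ?_⟩)⟩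
    intro i; exact_mod_cast hnear i
  have hBμ : ∀ η : ZdEdge d → S, (γ Λ η).real B ≤ M * δ' := by
    intro η
    haveI := hγ.isProbability Λ η
    have h1 : (γ Λ η) B ≤ ∑ c ∈ YΛ, (γ Λ η) (Good x c)ᶜ := measure_biUnion_finset_le _ _
    have h2 : ∑ c ∈ YΛ, (γ Λ η) (Good x c)ᶜ ≤ ∑ c ∈ YΛ, ENNReal.ofReal δ' := by
      refine Finset.sum_le_sum fun c hc => hBad x c Λ (fun v hv => ?_) η
      obtain ⟨w, hw, rfl⟩ := Finset.mem_image.1 hc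
      exact hΛ w v hv.symm (Finset.mem_filter.1 hw).1
    rw [Finset.sum_const, nsmul_eq_mul] at h2
    have h3 : (γ Λ η) B ≤ (YΛ.card : ENNReal) * ENNReal.ofReal δ' := h1.trans h2
    have h4 : ((YΛ.card : ENNReal) * ENNReal.ofReal δ').toReal = YΛ.card * δ' := by
      rw [ENNReal.toReal_mul, ENNReal.toReal_natCast, ENNReal.toReal_ofReal hδ']
    calc (γ Λ η).real B = ((γ Λ η) B).toReal := rfl
      _ ≤ ((YΛ.card : ENNReal) * ENNReal.ofReal δ').toReal :=
          ENNReal.toReal_mono (ENNReal.mul_ne_top (ENNReal.natCast_ne_top _)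
            ENNReal.ofReal_ne_top) h3
      _ = YΛ.card * δ' := h4
      _ ≤ M * δ' := by
          refine mul_le_mul_of_nonneg_right ?_ hδ'
          rw [hM]; exact_mod_cast hYΛcard
  -- under `γ_Λ(· | η)`, `η = ζ` on the cube-and-shell edges off `Λ`: off `B`, `g₀ = a + ε H` a.s.
  have hkey : ∀ η : ZdEdge d → S, (∀ v, v ∉ Λ → (∀ i, |cell v i - x i| ≤ R + 1) → η v = ζ v) →
      ∀ᵐ σ ∂(γ Λ η), σ ∉ B → g₀ σ = a + ε * H σ := by
    intro η hη
    filter_upwards [hγ.proper Λ η] with σ hσ hσB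
    have hσR : σ ∈ Rgood := by
      refine ⟨fun v hv hd => ?_, fun v hvΛ hvΛ₀ hd => ?_⟩
      · rw [hσ v hv]; exact hη v hv hd
      · by_contra hbad
        refine hσB (Set.mem_iUnion₂.2 ⟨cell v, ?_, hbad⟩)
        exact Finset.mem_image.2 ⟨v, Finset.mem_filter.2 ⟨hvΛ, hvΛ₀, hd⟩, rfl⟩
    have hΦσ : g₀ (Φ σ) = g₀ σ := by
      refine hg₀dep fun v hv => ?_
      obtain ⟨hv₀, hvd⟩ := hv
      by_cases hc : cell v ∈ Ysh
      · simp only [Φ, hc, if_true]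
      · simp only [Φ, hc, if_false]
        by_cases hvΛ : v ∈ Λ
        · exfalso
          refine hc (Finset.mem_filter.2 ⟨Finset.mem_image_of_mem _ hvΛ, hvd, fun hd => ?_⟩)
          exact hv₀ (Finset.mem_filter.2 ⟨hvΛ, hd⟩)
        · rw [hσ v hvΛ, hη v hvΛ hvd]
    have h1 := ha_le σ hσR
    have h2 := hle_a σ hσR
    simp only [hH, hΦσ]
    rcases hε.eq_or_lt with hε0 | hεpos
    · rw [← hε0, zero_mul, add_zero]
      rw [← hε0, add_zero] at h2
      exact le_antisymm h2 h1
    · have ht0 : 0 ≤ (g₀ σ - a) / ε := div_nonneg (by linarith) hεpos.le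
      have ht1 : (g₀ σ - a) / ε ≤ 1 := by rw [div_le_one hεpos]; linarith
      rw [max_eq_right ht0, min_eq_right ht1]
      field_simp
      ring
  -- TEMPERED: `∫ g₀ = a + ε ∫ H` up to the defect `2 γ_Λ(η)(B) ≤ 2 M δ'`
  have hint : ∀ η : ZdEdge d → S, (∀ v, v ∉ Λ → (∀ i, |cell v i - x i| ≤ R + 1) → η v = ζ v) →
      |∫ σ, g₀ σ ∂(γ Λ η) - (a + ε * ∫ σ, H σ ∂(γ Λ η))| ≤ 2 * (M * δ') := by
    intro η hη
    haveI := hγ.isProbability Λ η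
    have hHi : Integrable H (γ Λ η) := DobrushinMetric.integrable_of_abs_le' hHm (M := 1)
      fun σ => by rw [abs_of_nonneg (hH01 σ).1]; exact (hH01 σ).2
    have hg₀i : Integrable g₀ (γ Λ η) := DobrushinMetric.integrable_of_abs_le' hg₀m (M := 1)
      fun σ => by rw [abs_of_nonneg (hg₀01 σ).1]; exact (hg₀01 σ).2
    have hi2 : Integrable (fun σ => a + ε * H σ) (γ Λ η) :=
      (integrable_const a).add (hHi.const_mul ε)
    have hF : ∫ σ, g₀ σ ∂(γ Λ η) - (a + ε * ∫ σ, H σ ∂(γ Λ η)) =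
        ∫ σ, (g₀ σ - (a + ε * H σ)) ∂(γ Λ η) := by
      rw [integral_sub hg₀i hi2, integral_add (integrable_const a) (hHi.const_mul ε),
        integral_const, integral_const_mul]
      simp
    rw [hF]
    have hbound : ∀ᵐ σ ∂(γ Λ η), |g₀ σ - (a + ε * H σ)| ≤ B.indicator (fun _ => (2 : ℝ)) σ := by
      filter_upwards [hkey η hη] with σ hσ
      by_cases hσB : σ ∈ B
      · rw [Set.indicator_of_mem hσB]
        have := hg₀01 σ; have := hH01 σ
        have hεH : 0 ≤ ε * H σ ∧ ε * H σ ≤ 1 :=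
          ⟨mul_nonneg hε (hH01 σ).1, (mul_le_mul hε1 (hH01 σ).2 (hH01 σ).1 zero_le_one).trans
            (by rw [one_mul])⟩
        rw [abs_le]; constructor <;> linarith [ha01.1, ha01.2, hεH.1, hεH.2, (hg₀01 σ).1,
          (hg₀01 σ).2]
      · rw [Set.indicator_of_notMem hσB, hσ hσB, sub_self, abs_zero]
    calc |∫ σ, (g₀ σ - (a + ε * H σ)) ∂(γ Λ η)|
        ≤ ∫ σ, |g₀ σ - (a + ε * H σ)| ∂(γ Λ η) := abs_integral_le_integral_abs
      _ ≤ ∫ σ, B.indicator (fun _ => (2 : ℝ)) σ ∂(γ Λ η) :=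
          integral_mono_ae (hg₀i.sub hi2).abs
            ((integrable_const (2 : ℝ)).indicator hBm) hbound
      _ = (γ Λ η).real B * 2 := by rw [integral_indicator_const _ hBm, smul_eq_mul]
      _ ≤ M * δ' * 2 := mul_le_mul_of_nonneg_right (hBμ η) zero_le_two
      _ = 2 * (M * δ') := by ring
  -- the chain rule over the shell cells (UNCHANGED)
  have hchain : |∫ σ, H σ ∂(γ Λ ζ) - ∫ σ, H σ ∂(γ Λ ζ')| ≤ Ysh.card * δ := by
    refine multiCell_influence_general (cell := cell)
      (near := fun y v => ∀ i, |cell v i - y i| ≤ j * (2 * n + 1))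
      (fun v i => by rw [sub_self, abs_zero]; positivity) hγ hT Ysh Λ hΛ H hHm hH01 hHdep ζ ζ'
      fun y hy v hv hd => hagree v hv fun i => ?_
    have hy1 : |y i - x i| ≤ R + 1 := ((Finset.mem_filter.1 hy).2.1) i
    calc |cell v i - x i| = |(cell v i - y i) + (y i - x i)| := by ring_nf
      _ ≤ |cell v i - y i| + |y i - x i| := abs_add_le _ _
      _ ≤ j * (2 * n + 1) + (R + 1) := add_le_add (hd i) hy1
      _ = (j + 1) * (2 * n + 1) := by rw [hR]; ring
  -- at most `M` shell cells
  have hcard : Ysh.card ≤ (2 * (2 * n + 1) + 1) ^ d - (2 * (2 * n) + 1) ^ d := by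
    refine card_shell_le x (2 * n) Ysh fun y hy => ?_
    have h := (Finset.mem_filter.1 hy).2
    simp only [hR] at h
    exact_mod_cast h
  have hchainM : |∫ σ, H σ ∂(γ Λ ζ) - ∫ σ, H σ ∂(γ Λ ζ')| ≤ M * δ :=
    hchain.trans (mul_le_mul_of_nonneg_right (by rw [hM]; exact_mod_cast hcard) hδ)
  -- assemble
  have hζ' : ∀ v, v ∉ Λ → (∀ i, |cell v i - x i| ≤ R + 1) → ζ' v = ζ v := fun v hv hd =>
    (hagree v hv fun i => (hd i).trans hR1).symm
  have hA := hint ζ (fun _ _ _ => rfl)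
  have hA' := hint ζ' hζ'
  rw [hcons ζ, hcons ζ']
  have hsplit : ∫ σ, g₀ σ ∂(γ Λ ζ) - ∫ σ, g₀ σ ∂(γ Λ ζ') =
      (∫ σ, g₀ σ ∂(γ Λ ζ) - (a + ε * ∫ σ, H σ ∂(γ Λ ζ))) +
        (-(∫ σ, g₀ σ ∂(γ Λ ζ') - (a + ε * ∫ σ, H σ ∂(γ Λ ζ')))) +
          ε * (∫ σ, H σ ∂(γ Λ ζ) - ∫ σ, H σ ∂(γ Λ ζ')) := by ring
  rw [hsplit]
  refine (abs_add_three _ _ _).trans ?_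
  rw [abs_neg, abs_mul, abs_of_nonneg hε]
  have hεM : ε * |∫ σ, H σ ∂(γ Λ ζ) - ∫ σ, H σ ∂(γ Λ ζ')| ≤ ε * (M * δ) :=
    mul_le_mul_of_nonneg_left hchainM hε
  calc |∫ σ, g₀ σ ∂(γ Λ ζ) - (a + ε * ∫ σ, H σ ∂(γ Λ ζ))| +
        |∫ σ, g₀ σ ∂(γ Λ ζ') - (a + ε * ∫ σ, H σ ∂(γ Λ ζ'))| +
          ε * |∫ σ, H σ ∂(γ Λ ζ) - ∫ σ, H σ ∂(γ Λ ζ')|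
      ≤ 2 * (M * δ') + 2 * (M * δ') + ε * (M * δ) := add_le_add (add_le_add hA hA') hεM
    _ = ε * M * δ + 4 * M * δ' := by ring

end Summit.QuantumFields.YangMills.Cruxes.IR.CellTempered.OuterEngine

end
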